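import Summits.ResolutionOfSingularities.ResolutionOfSingularities.Theorems.EquisingularLiftEquisingularLiftNatDefTowerBQuadPrimePointResolutionThree
import Summits.ResolutionOfSingularities.ResolutionOfSingularities.Theorems.EquisingularLiftEquisingularLiftNatNDRungClosure
import Summits.ResolutionOfSingularities.ResolutionOfSingularities.Theorems.EquisingularLiftEquisingularLiftNatResidueHypDefs
import Summits.ResolutionOfSingularities.ResolutionOfSingularities.Theorems.EquisingularLiftEquisingularLiftNatResidueHypDefsND
import HarnessLib

/-!
# [OURS · L1 W4.5(b) · EL♮(3)] SPEC K6 v2 — «A⁗-PREFIX ⊕ ND LEAVES» (v2 = v1 d188b13819caf1a5 RE-HOMED on the 35th ✓ p647090 `…NatNDRungClosure`: `ND.hsub_strataLift` and `ND.ndInvLN_round` used BY NAME, in-file copies dropped; statements of (K6-1)/(K6-2)/rung byte-identical) (desk RULING R33 (β), 2026-08-28T15:54:17Z; card `toric-towers` ROUND 14 «K6»)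

res-L1-w45b-idea-1 g23 (spec / invariant text author).  [OURS · counted 0 · AI-written, weaker than expert review; nothing of [Hironaka2017] is asserted
(its statements are CANDIDATES, never premises); NOT a statement of the manuscript; EL♮(3) is NOT proved here; resolution in char p is NOT proved.]
Farm `lean check`: sorries = 0 (the ND round `ND.ndInvLN_round` and HSUB(toric) `ND.hsub_strataLift` are TREE THEOREMS of the 35th ✓ p647090); every composition
PROVED; the rung is conditional only on `EmbeddedCurveLiftFact` (T-k, F-88) exactly as rung⁵.

## (K6-1) THE HYPOTHESIS `IsoHypReachNDLeaves k n H ι` (house style R21″: ONE blob)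
«some A⁗-prefix — point steps at non-regular points of the reduced strict transform that are regular points of the ambient, B‴ towers `ReachTowerBTriplePrime`
after them, and at the INITIAL stage lettered B⁗ towers `ReachTowerBQuadPrime ℙⁿ_k` seeded by strict transforms of hyperplanes through the blown-up point not
containing `H` (blob #21 `IsoHypDefTowerBQuadPrime`'s two closure clauses VERBATIM: `PrefixReachBQuadPrime`) — ENDS at a k-side stage `(F, ρ, T)` carrying the
locally-Noetherian ND invariant `ND.NDInvCLN n k m F ρ T` (port ✓ p643982 over ✓ p639684): `F` regular and locally Noetherian, `T` closed, the non-regular points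
of the reduced closure of `T` are exactly a finite set of `m` points, each with LOCAL ND FRAME DATA `ND.IsNDFrameAt` (an r.s.p. frame `w` of `𝒪_{F,x}` cut out
by prime divisors `W j` through `x`, and a won local-ND polynomial `g` with `(𝓘_{closure T, red})_x = (g(w))`).»  `isoHypDefTowerBQuadPrime_iff` records blob #21 =
`PrefixReachBQuadPrime ∧ regular end` (`Iff.rfl`): the new blob differs from blob #21 EXACTLY in its end clause (regular end ↦ ND leaves).

NO «frame adapted to the boundary» clause (the desk's reading (N1)) — none is needed: EL♮'s conclusion `ELNatConclusionO` carries no boundary condition; the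
O-side chain discipline `Ch`/HSUB asks of a centre only {regular, O-flat, image off the generic point of `Y`, special fibre inside the strict transform} — no
E1/boundary legality; and `ND.ReachToric`'s centres are strata of the FRAME boundary `frameBoundary W` stepped along the rounds (old exceptional components of the
prefix through the leaf are not members and need not be).  E1-legality is a discipline of the k-side SEARCH (A-engine / walker), not of the rung.  Should the
desk want boundary-adapted leaves for the walker's bookkeeping, that is a STRONGER blob served by the SAME rung (monotone in the blob).

## (K6-2) THE GLUING THEOREM `target_elnat_of_prefix_then_ndRounds` (any `n`; PROVED, no sorry) — what it composes
K5″ `target_elnat_of_subchainResolution_letters` (✓ p634794) at `Reach := ReachTowerBTriplePrime ∨ ND.ReachToric n`, `ReachL := ReachTowerBQuadPrime ℙⁿ_k`,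
`LS :=` blob #21's hyperplane-letter predicate (instance⁵ `stub_elnat_defTowerBQuadPrimePointResolution_of_subchainLift`'s lambdas VERBATIM), with
* HSUB(B‴ ∨ toric) := case split (`Or.elim`) of the HYPOTHESIS HSUB₁(ReachTowerBTriplePrime) [instance⁵'s first supplier shape VERBATIM; at `n = 3` it is
  stub-4's V10⁗-full `hsub_reachTowerBTriplePrime_of_fact_full` ∘ (T-k) `EmbeddedCurveLiftFact` (F-88) ∘ res-type-027's `inv_baseSL` — rung⁵'s lambda] and
  `ND.hsub_strataLift` (35th ✓ p647090; = SPEC ND-K5 §13.2: `ND.hsub_strataLift_of_invariant` ✓ p639684 over `ND.SNCInv₂` with (B3a) ✓ p642183 `sncInv_init`, (B3g)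
  ✓ p641592 `sncInv_stratumFacts`, (B3b) ✓ p641843 `sncInv_stepFacts` — STAGE-GENERIC: it lifts toric rounds begun at ANY `Ch`-stage, in particular at the
  prefix's end stage);
* HSUB₂(lettered B⁗, initial stage) := HYPOTHESIS [instance⁵'s second supplier shape VERBATIM; at `n = 3` it is stub-4's V10⁵-full
  `hsub_reachTowerBQuadPrime_of_fact_full` (✓ p635361) with res-type-027's `inv_baseSL_letters` / `inv_baseS₀L_letters` and (H3)/(H4-T) — rung⁵'s lambda];
* hres := from `IsoHypReachNDLeaves`: the prefix puts every admissible motive `Q` at its end stage (the B‴/B⁗ clauses are the `Or.inl` half of the K5″ closure),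
  and `ND.rounds_resolve` (✓ p638808; STAGE-GENERIC strong induction on `m`) from `ND.NDInvCLN n k m F ρ T`, `ND.ndInvCLN_end` (✓ p643982) and the ROUND
  `ND.RoundFacts n k (ND.NDInvCLN n k)` (HYPOTHESIS of (K6-2); discharged in the rung by the TREE theorem `ND.ndInvLN_round`, 35th ✓ p647090, k-side census 8/8)
  reaches a resolved end through the `Or.inr` half.
GENUINELY NEW CONTENT: NONE on either side — (N1) is vacuous under this typing (above); (N2) = the ~25 lines of logic of (K6-2).  The programme's content sits
entirely in the CUSTOMERS of the blob (which `H` admit a short A⁗-prefix all of whose leaves are ND in some frame): lead-1 g14's leaf test (desk R33 (β)/(γ)).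

## THE RUNG `nd_leaves_rung_three` (n = 3; sorries 0; the ND round is the tree's `ND.ndInvLN_round`) · MONOTONICITY · (K6-3) cheapest falsifier
`EmbeddedCurveLiftFact → p.Prime → … → IsoHypReachNDLeaves k 3 H ι → ELNatConclusionO k 3 H ι` := (K6-2) fed with rung⁵
`stub_elnat_defTowerBQuadPrimePointResolutionThree`'s two supplier lambdas VERBATIM (same imports, same instances).
MONOTONICITY `isoHypReachNDLeaves_of_isoHypNDWon` (PROVED from ✓ p645490 `ND.ndInv_init`): the EMPTY prefix shows the ND-K5 stub's hypothesis
(`IsoHypNDWon` + finitely many non-regular points) is a special case — so the 37th cut (desk (γ)) can REPLACE the ND blob by this one rather than add a conjunct.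
(K6-3) CHEAPEST FALSIFIER.  Of the PROGRAMME (the rung is glue, nothing in it can be false except the 35th): a surface `H ⊂ ℙ³_k` for which NO A⁗-prefix ends
with all leaves ND in SOME frame — decided per specimen by lead-1's walker plus the NNR §10.2 exponent-table test at the prefix's end charts; first customers:
the BP germs `x^a + y^b + z^c` with `p ∣ abc` that are non-ND at floor 0 in the given frame, and the heavy BP germs left undecided at T3/T4 (lead-1 memo v2.4).
Of the TYPING: a leaf that is ND in formal / étale coordinates at `x` but in NO frame of `ND.IsNDFrameAt`'s kind (divisors `W j` closed, prime AT `x`, cutting an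
r.s.p. of `𝒪_{F,x}`, with `g(w)` generating `(𝓘_{closure T, red})_x` for a POLYNOMIAL `g` over `baseToStalk`) — e.g. ND only after a non-algebraic coordinate
change; such leaves are outside the blob by design (the same stalk-level clauses ✓ p645490 met at floor 0), and would call for a Weierstrass-prepared variant
of `IsNDFrameAt`, not for a change of the rung.
-/

set_option linter.dupNamespace false -- mandated namespace `Summit.<Summit>.<Problem>` of this single-conjunct summit
set_option linter.overlappingInstances false -- signatures carry `[IsDomain O] [IsDiscreteValuationRing O]`

noncomputable section

open CategoryTheory CategoryTheory.Limits AlgebraicGeometry TopologicalSpace Topology IsLocalRing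
open Literature.AlgebraicGeometry.Resolution
open AlgebraicGeometry.Scheme.IdealSheafData
open Summit.ResolutionOfSingularities.ResolutionOfSingularities.Theses.EquisingularLift.Split
open Summit.ResolutionOfSingularities.ResolutionOfSingularities.Cruxes.EquisingularLift.StrataSplit

attribute [local instance] MvPolynomial.gradedAlgebra

namespace Summit.ResolutionOfSingularities.ResolutionOfSingularities.Cruxes.EquisingularLiftNat.Sections

/-- **The A⁗-PREFIX REACH predicate** `PrefixReachBQuadPrime k n H ι F' ρ' T'`: the stage `(F', ρ', T')` is reached from `(ℙⁿ_k, 𝟙, range ι)` through every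
point-resolution motive `Q` closed under blob #21's two clauses (point steps + B‴ towers at any stage; lettered B⁗ towers at the initial stage) — blob #21
`IsoHypDefTowerBQuadPrime`'s `∀ Q`-part VERBATIM with its end clause removed (`isoHypDefTowerBQuadPrime_iff`).
[OURS · L1 W4.5b · named predicate, no mathematical content of its own] -/
def PrefixReachBQuadPrime (k : Type) [Field k] [IsAlgClosed k] (n : ℕ) (H : AlgebraicGeometry.Scheme.{0})
    (ι : H ⟶ (Literature.AlgebraicGeometry.Motives.projectiveSpace n k).left) (F' : AlgebraicGeometry.Scheme.{0})
    (ρ' : F' ⟶ (Literature.AlgebraicGeometry.Motives.projectiveSpace n k).left) (T' : Set F') : Prop :=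
  (∀ Q : (∀ F₁ : AlgebraicGeometry.Scheme.{0}, (F₁ ⟶ (Literature.AlgebraicGeometry.Motives.projectiveSpace n k).left) → Set F₁ → Prop), Q (Literature.AlgebraicGeometry.Motives.projectiveSpace n k).left (CategoryTheory.CategoryStruct.id (Literature.AlgebraicGeometry.Motives.projectiveSpace n k).left) (Set.range ι) → (∀ (F₁ F₂ : AlgebraicGeometry.Scheme.{0}) (ρ : F₁ ⟶ (Literature.AlgebraicGeometry.Motives.projectiveSpace n k).left) (T₁ : Set F₁) (x : ↥(AlgebraicGeometry.Scheme.IdealSheafData.vanishingIdeal (⟨closure T₁, isClosed_closure⟩ : TopologicalSpace.Closeds F₁)).subscheme) (υ : F₂ ⟶ F₁) (hx : IsClosed ({((AlgebraicGeometry.Scheme.IdealSheafData.vanishingIdeal (⟨closure T₁, isClosed_closure⟩ : TopologicalSpace.Closeds F₁)).subschemeι x : F₁)} : Set F₁)), Q F₁ ρ T₁ → ¬ IsRegularLocalRing ((AlgebraicGeometry.Scheme.IdealSheafData.vanishingIdeal (⟨closure T₁, isClosed_closure⟩ : TopologicalSpace.Closeds F₁)).subscheme.presheaf.stalk x) → IsRegularLocalRing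 (F₁.presheaf.stalk ((AlgebraicGeometry.Scheme.IdealSheafData.vanishingIdeal (⟨closure T₁, isClosed_closure⟩ : TopologicalSpace.Closeds F₁)).subschemeι x)) → Literature.AlgebraicGeometry.Resolution.IsBlowup υ (AlgebraicGeometry.Scheme.IdealSheafData.vanishingIdeal (⟨{((AlgebraicGeometry.Scheme.IdealSheafData.vanishingIdeal (⟨closure T₁, isClosed_closure⟩ : TopologicalSpace.Closeds F₁)).subschemeι x : F₁)}, hx⟩ : TopologicalSpace.Closeds F₁)) → Q F₂ (CategoryTheory.CategoryStruct.comp υ ρ) (closure (υ ⁻¹' (T₁ \ {((AlgebraicGeometry.Scheme.IdealSheafData.vanishingIdeal (⟨closure T₁, isClosed_closure⟩ : TopologicalSpace.Closeds F₁)).subschemeι x : F₁)}))) ∧ (∀ (F₉ : AlgebraicGeometry.Scheme.{0}) (β : F₉ ⟶ F₂) (T₉ : Set F₉), ReachTowerBTriplePrime F₁ F₂ υ ((AlgebraicGeometry.Scheme.IdealSheafData.vanishingIdeal (⟨closure T₁, isClosed_closure⟩ : TopologicalSpace.Closeds F₁)).subschemeι x) (closure (υ ⁻¹' (T₁ \ {((AlgebraicGeometry.Scheme.IdealSheafData.vanishingIdeal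 (⟨closure T₁, isClosed_closure⟩ : TopologicalSpace.Closeds F₁)).subschemeι x : F₁)}))) F₉ β T₉ → Q F₉ (CategoryTheory.CategoryStruct.comp (CategoryTheory.CategoryStruct.comp β υ) ρ) T₉))  → (∀ (F₂ : AlgebraicGeometry.Scheme.{0}) (x₀ : ↥(AlgebraicGeometry.Scheme.IdealSheafData.vanishingIdeal (⟨closure (Set.range ι), isClosed_closure⟩ : TopologicalSpace.Closeds (Literature.AlgebraicGeometry.Motives.projectiveSpace n k).left)).subscheme) (υ : F₂ ⟶ (Literature.AlgebraicGeometry.Motives.projectiveSpace n k).left) (hx₀ : IsClosed ({((AlgebraicGeometry.Scheme.IdealSheafData.vanishingIdeal (⟨closure (Set.range ι), isClosed_closure⟩ : TopologicalSpace.Closeds (Literature.AlgebraicGeometry.Motives.projectiveSpace n k).left)).subschemeι x₀ : (Literature.AlgebraicGeometry.Motives.projectiveSpace n k).left)} : Set (Literature.AlgebraicGeometry.Motives.projectiveSpace n k).left)) (Ls₂ : List (Set F₂)), ¬ IsRegularLocalRing ((AlgebraicGeometry.Scheme.IdealSheafData.vanishingIdeal (⟨closure (Set.range ι), isClosed_closure⟩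 : TopologicalSpace.Closeds (Literature.AlgebraicGeometry.Motives.projectiveSpace n k).left)).subscheme.presheaf.stalk x₀) → IsRegularLocalRing (((Literature.AlgebraicGeometry.Motives.projectiveSpace n k).left).presheaf.stalk ((AlgebraicGeometry.Scheme.IdealSheafData.vanishingIdeal (⟨closure (Set.range ι), isClosed_closure⟩ : TopologicalSpace.Closeds (Literature.AlgebraicGeometry.Motives.projectiveSpace n k).left)).subschemeι x₀ : (Literature.AlgebraicGeometry.Motives.projectiveSpace n k).left)) → Literature.AlgebraicGeometry.Resolution.IsBlowup υ (AlgebraicGeometry.Scheme.IdealSheafData.vanishingIdeal (⟨{((AlgebraicGeometry.Scheme.IdealSheafData.vanishingIdeal (⟨closure (Set.range ι), isClosed_closure⟩ : TopologicalSpace.Closeds (Literature.AlgebraicGeometry.Motives.projectiveSpace n k).left)).subschemeι x₀ : (Literature.AlgebraicGeometry.Motives.projectiveSpace n k).left)}, hx₀⟩ : TopologicalSpace.Closeds (Literature.AlgebraicGeometry.Motives.projectiveSpace n k).left)) → (letI := MvPolynomial.gradedAlgebra (σ := Fin (n + 1)) (R := k); ∀ L ∈ Ls₂, ∃ ℓ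 : MvPolynomial (Fin (n + 1)) k, ℓ.IsHomogeneous 1 ∧ ℓ ≠ 0 ∧ ((AlgebraicGeometry.Scheme.IdealSheafData.vanishingIdeal (⟨closure (Set.range ι), isClosed_closure⟩ : TopologicalSpace.Closeds (Literature.AlgebraicGeometry.Motives.projectiveSpace n k).left)).subschemeι x₀ : (Literature.AlgebraicGeometry.Motives.projectiveSpace n k).left) ∈ {y : (Literature.AlgebraicGeometry.Motives.projectiveSpace n k).left | ℓ ∈ (y : ProjectiveSpectrum (MvPolynomial.homogeneousSubmodule (Fin (n + 1)) k)).asHomogeneousIdeal} ∧ ¬ (Set.range ι ⊆ {y : (Literature.AlgebraicGeometry.Motives.projectiveSpace n k).left | ℓ ∈ (y : ProjectiveSpectrum (MvPolynomial.homogeneousSubmodule (Fin (n + 1)) k)).asHomogeneousIdeal}) ∧ L = closure (υ ⁻¹' ({y : (Literature.AlgebraicGeometry.Motives.projectiveSpace n k).left | ℓ ∈ (y : ProjectiveSpectrum (MvPolynomial.homogeneousSubmodule (Fin (n + 1)) k)).asHomogeneousIdeal} \ {((AlgebraicGeometry.Scheme.IdealSheafData.vanishingIdeal (⟨closure (Set.range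 ι), isClosed_closure⟩ : TopologicalSpace.Closeds (Literature.AlgebraicGeometry.Motives.projectiveSpace n k).left)).subschemeι x₀ : (Literature.AlgebraicGeometry.Motives.projectiveSpace n k).left)}))) → ∀ (F₉ : AlgebraicGeometry.Scheme.{0}) (β : F₉ ⟶ F₂) (T₉ : Set F₉), ReachTowerBQuadPrime (Literature.AlgebraicGeometry.Motives.projectiveSpace n k).left F₂ υ ((AlgebraicGeometry.Scheme.IdealSheafData.vanishingIdeal (⟨closure (Set.range ι), isClosed_closure⟩ : TopologicalSpace.Closeds (Literature.AlgebraicGeometry.Motives.projectiveSpace n k).left)).subschemeι x₀ : (Literature.AlgebraicGeometry.Motives.projectiveSpace n k).left) (closure (υ ⁻¹' (Set.range ι \ {((AlgebraicGeometry.Scheme.IdealSheafData.vanishingIdeal (⟨closure (Set.range ι), isClosed_closure⟩ : TopologicalSpace.Closeds (Literature.AlgebraicGeometry.Motives.projectiveSpace n k).left)).subschemeι x₀ : (Literature.AlgebraicGeometry.Motives.projectiveSpace n k).left)}))) Ls₂ F₉ β T₉ → Q F₉ (CategoryTheory.CategoryStruct.comp β υ) T₉) → Q F' ρ' T')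

/-- Blob #21 `IsoHypDefTowerBQuadPrime` = «an A⁗-prefix reaches a stage with REGULAR reduced strict transform» (definitional). [OURS · pure logic] -/
theorem isoHypDefTowerBQuadPrime_iff (k : Type) [Field k] [IsAlgClosed k] (n : ℕ) (H : AlgebraicGeometry.Scheme.{0})
    (ι : H ⟶ (Literature.AlgebraicGeometry.Motives.projectiveSpace n k).left) :
    IsoHypDefTowerBQuadPrime k n H ι ↔
      ∃ (F' : AlgebraicGeometry.Scheme.{0}) (ρ' : F' ⟶ (Literature.AlgebraicGeometry.Motives.projectiveSpace n k).left) (T' : Set F'),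
        PrefixReachBQuadPrime k n H ι F' ρ' T' ∧ Literature.AlgebraicGeometry.Resolution.Scheme.IsRegular (AlgebraicGeometry.Scheme.IdealSheafData.vanishingIdeal (⟨closure T', isClosed_closure⟩ : TopologicalSpace.Closeds F')).subscheme :=
  Iff.rfl

/-- **(K6-1) `IsoHypReachNDLeaves k n H ι`** — «an A⁗-prefix ends at a stage with ND LEAVES»: some stage `(F, ρ, T)` reached by `PrefixReachBQuadPrime` carries
the locally-Noetherian ND invariant `ND.NDInvCLN n k m F ρ T` (port ✓ p643982 over ✓ p639684: `F` regular and locally Noetherian, `T` closed, the non-regular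
points of the reduced closure of `T` = `m` points, each with `ND.IsNDFrameAt` data).  House style R21″: ONE blob; the ONE extra hypothesis of the rung
`nd_leaves_rung_three`. [OURS · L1 W4.5b · named hypothesis, no mathematical content of its own] -/
def IsoHypReachNDLeaves (k : Type) [Field k] [IsAlgClosed k] (n : ℕ) (H : AlgebraicGeometry.Scheme.{0})
    (ι : H ⟶ (Literature.AlgebraicGeometry.Motives.projectiveSpace n k).left) : Prop :=
  ∃ (F : AlgebraicGeometry.Scheme.{0}) (ρ : F ⟶ (Literature.AlgebraicGeometry.Motives.projectiveSpace n k).left) (T : Set F) (m : ℕ),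
    PrefixReachBQuadPrime k n H ι F ρ T ∧ ND.NDInvCLN n k m F ρ T

-- HSUB(ReachToric) = `ND.hsub_strataLift` and the ND round `ND.ndInvLN_round` are TREE THEOREMS since the 35th ✓ p647090 `…NatNDRungClosure` (v1 carried
-- in-file copies `ND.hsub_strataLiftK6` / `ndInvLN_round`; dropped in v2).

/-- **(K6-2) THE GLUING THEOREM `target_elnat_of_prefix_then_ndRounds`** (any `n`; PROVED): K5″ at `Reach := ReachTowerBTriplePrime ∨ ND.ReachToric n` with
blob #21's initial-stage letters; suppliers HSUB₁(B‴) and HSUB₂(lettered B⁗) as HYPOTHESES in instance⁵'s shapes VERBATIM (at `n = 3`: rung⁵'s two lambdas),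
HSUB(toric) = `ND.hsub_strataLift` (35th ✓ p647090); the ND round `ND.RoundFacts n k (ND.NDInvCLN n k)` (= `ND.ndInvLN_round`, 35th) as HYPOTHESIS; k-side = prefix reach, then `ND.rounds_resolve`
from the end stage.  See the module docstring (K6-2). [folklore; pure logic over K5″ ✓ p634794 · ✓ p638808 · ✓ p639684 · ✓ p643982] [OURS · L1 W4.5b] -/
theorem target_elnat_of_prefix_then_ndRounds (p : ℕ) : p.Prime → ∀ (k : Type) [Field k] [CharP k p] [IsAlgClosed k] (n : ℕ) (H :
    AlgebraicGeometry.Scheme.{0}) (ι : H ⟶ (Literature.AlgebraicGeometry.Motives.projectiveSpace n k).left), AlgebraicGeometry.IsClosedImmersion ι → AlgebraicGeometry.IsIntegral H →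
    (∀ y : (Literature.AlgebraicGeometry.Motives.projectiveSpace n k).left, ∃ U : (Literature.AlgebraicGeometry.Motives.projectiveSpace n k).left.affineOpens, y ∈ (U :
    (Literature.AlgebraicGeometry.Motives.projectiveSpace n k).left.Opens) ∧ (ι.ker.ideal U).IsPrincipal) → (∀ (O : Type) [CommRing O] [IsDomain O] [IsDiscreteValuationRing O]
    [IsAdicComplete (IsLocalRing.maximalIdeal O) O] [IsAlgClosed (IsLocalRing.ResidueField O)] (θ : O →+* k), Function.Surjective θ → ∀ (P : AlgebraicGeometry.Scheme.{0}) (q : P ⟶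
    AlgebraicGeometry.Spec (.of O)) (Y : Set P) (Ch : ∀ X' : AlgebraicGeometry.Scheme.{0}, (X' ⟶ P) → Set X' → Prop), (∀ (X' X'' : AlgebraicGeometry.Scheme.{0}) (σ' : X' ⟶ P) (S' :
    Set X') (C : X'.IdealSheafData) (τ : X'' ⟶ X'), Ch X' σ' S' → Literature.AlgebraicGeometry.Resolution.IsBlowup τ C → Literature.AlgebraicGeometry.Resolution.Scheme.IsRegular
    C.subscheme → AlgebraicGeometry.Flat (C.subschemeι ≫ σ' ≫ q) → σ' '' (C.support : Set X') ⊆ {y | ¬ IsGenericPoint y Y} → (C.support : Set X') ∩ (σ' ≫ q) ⁻¹'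
    {IsLocalRing.closedPoint O} ⊆ S' → Ch X'' (τ ≫ σ') (closure (τ ⁻¹' (S' \ (C.support : Set X'))))) → (∀ (X' : AlgebraicGeometry.Scheme.{0}) (σ' : X' ⟶ P) (S' : Set X'), Ch X' σ'
    S' → Summit.ResolutionOfSingularities.ResolutionOfSingularities.Theses.EquisingularLift.Split.Chain P Y X' σ' S') → Y ⊆ q ⁻¹' {IsLocalRing.closedPoint O} → IsIrreducible Y →
    IsClosed Y → AlgebraicGeometry.IsIntegral P → IsLocallyNoetherian P → Literature.AlgebraicGeometry.Resolution.Scheme.IsRegular P → AlgebraicGeometry.IsProper q →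
    AlgebraicGeometry.SmoothOfRelativeDimension n q → ∀ (X' : AlgebraicGeometry.Scheme.{0}) (σ' : X' ⟶ P) (S' : Set X'), Ch X' σ' S' → AlgebraicGeometry.IsIntegral X' →
    IsLocallyNoetherian X' → Literature.AlgebraicGeometry.Resolution.Scheme.IsRegular X' → AlgebraicGeometry.IsDominant (σ' ≫ q) → ∀ (F₁ : AlgebraicGeometry.Scheme.{0}),
    AlgebraicGeometry.IsIntegral F₁ → ∀ (j : F₁ ⟶ X') (t : F₁ ⟶ AlgebraicGeometry.Spec (.of k)), IsPullback j t (σ' ≫ q) (AlgebraicGeometry.Spec.map (CommRingCat.ofHom θ)) → ∀ (T₁ :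
    Set F₁), IsClosed T₁ → IsIrreducible T₁ → j '' T₁ = S' → ∀ (x : F₁) (hx : IsClosed ({x} : Set F₁)) (U : X'.Opens), AlgebraicGeometry.Smooth (U.ι ≫ σ' ≫ q) → ∀ (s :
    AlgebraicGeometry.Spec (.of O) ⟶ X'), s ≫ σ' ≫ q = 𝟙 _ → s (IsLocalRing.closedPoint O) ∈ U → s (IsLocalRing.closedPoint O) = j x → ringKrullDim (X'.presheaf.stalk (s
    (IsLocalRing.closedPoint O))) = ((n + 1 : ℕ) : WithBot ℕ∞) → IsRegularLocalRing (F₁.presheaf.stalk x) → (∀ c ∈ (s.ker.support : Set X'), ¬ IsGenericPoint (σ' c) Y) → ∀ (X₁ :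
    AlgebraicGeometry.Scheme.{0}) (τ₁ : X₁ ⟶ X'), Literature.AlgebraicGeometry.Resolution.IsBlowup τ₁ s.ker → AlgebraicGeometry.IsIntegral X₁ → IsLocallyNoetherian X₁ →
    Literature.AlgebraicGeometry.Resolution.Scheme.IsRegular X₁ → AlgebraicGeometry.IsDominant ((τ₁ ≫ σ') ≫ q) → ∀ (F₂ : AlgebraicGeometry.Scheme.{0}), AlgebraicGeometry.IsIntegral
    F₂ → ∀ (υ : F₂ ⟶ F₁), Literature.AlgebraicGeometry.Resolution.IsBlowup υ (AlgebraicGeometry.Scheme.IdealSheafData.vanishingIdeal (⟨{x}, hx⟩ : TopologicalSpace.Closeds F₁)) → ∀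
    (j₂ : F₂ ⟶ X₁) (t₂ : F₂ ⟶ AlgebraicGeometry.Spec (.of k)), IsPullback j₂ t₂ ((τ₁ ≫ σ') ≫ q) (AlgebraicGeometry.Spec.map (CommRingCat.ofHom θ)) → j₂ ≫ τ₁ = υ ≫ j → (s.ker.comap
    τ₁).comap j₂ = (AlgebraicGeometry.Scheme.IdealSheafData.vanishingIdeal (⟨{x}, hx⟩ : TopologicalSpace.Closeds F₁)).comap υ → IsIrreducible (closure (υ ⁻¹' (T₁ \ {x}))) → Ch X₁ (τ₁
    ≫ σ') (j₂ '' closure (υ ⁻¹' (T₁ \ {x}))) → ∀ (F₉ : AlgebraicGeometry.Scheme.{0}) (β : F₉ ⟶ F₂) (T₉ : Set F₉), ReachTowerBTriplePrime F₁ F₂ υ x (closure (υ ⁻¹' (T₁ \ {x}))) F₉ β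
    T₉ → ∃ (X₉ : AlgebraicGeometry.Scheme.{0}) (σ₉ : X₉ ⟶ P) (S₉ : Set X₉) (j₉ : F₉ ⟶ X₉) (t₉ : F₉ ⟶ AlgebraicGeometry.Spec (.of k)), Ch X₉ σ₉ S₉ ∧ AlgebraicGeometry.IsIntegral X₉ ∧
    IsLocallyNoetherian X₉ ∧ Literature.AlgebraicGeometry.Resolution.Scheme.IsRegular X₉ ∧ AlgebraicGeometry.IsDominant (σ₉ ≫ q) ∧ IsPullback j₉ t₉ (σ₉ ≫ q)
    (AlgebraicGeometry.Spec.map (CommRingCat.ofHom θ)) ∧ j₉ '' T₉ = S₉ ∧ IsClosed T₉ ∧ IsIrreducible T₉ ∧ AlgebraicGeometry.IsIntegral F₉) → (∀ (O : Type) [CommRing O] [IsDomain O]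
    [IsDiscreteValuationRing O] [IsAdicComplete (IsLocalRing.maximalIdeal O) O] [IsAlgClosed (IsLocalRing.ResidueField O)] (θ : O →+* k), Function.Surjective θ →
    (letI := MvPolynomial.gradedAlgebra (σ := Fin (n + 1)) (R := O); letI := MvPolynomial.gradedAlgebra (σ := Fin (n + 1)) (R := k); ∀ (φ : MvPolynomial.homogeneousSubmodule (Fin (n
    + 1)) O →+*ᵍ MvPolynomial.homogeneousSubmodule (Fin (n + 1)) k) (hφ' : HomogeneousIdeal.irrelevant (MvPolynomial.homogeneousSubmodule (Fin (n + 1)) k) ≤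
    (HomogeneousIdeal.irrelevant (MvPolynomial.homogeneousSubmodule (Fin (n + 1)) O)).map φ), (∀ s, φ s = MvPolynomial.map θ s) → ∀ (Ch : ∀ X' : AlgebraicGeometry.Scheme.{0}, (X' ⟶
    (AlgebraicGeometry.Proj (MvPolynomial.homogeneousSubmodule (Fin (n + 1)) O))) → Set X' → Prop), (∀ (X' X'' : AlgebraicGeometry.Scheme.{0}) (σ' : X' ⟶ (AlgebraicGeometry.Proj
    (MvPolynomial.homogeneousSubmodule (Fin (n + 1)) O))) (S' : Set X') (C : X'.IdealSheafData) (τ : X'' ⟶ X'), Ch X' σ' S' → Literature.AlgebraicGeometry.Resolution.IsBlowup τ C →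
    Literature.AlgebraicGeometry.Resolution.Scheme.IsRegular C.subscheme → AlgebraicGeometry.Flat (C.subschemeι ≫ σ' ≫ (AlgebraicGeometry.Proj.toSpecZero
    (MvPolynomial.homogeneousSubmodule (Fin (n + 1)) O) ≫ AlgebraicGeometry.Spec.map (CommRingCat.ofHom (algebraMap O (MvPolynomial.homogeneousSubmodule (Fin (n + 1)) O 0))))) → σ'
    '' (C.support : Set X') ⊆ {y | ¬ IsGenericPoint y (Set.range (ι ≫ AlgebraicGeometry.Proj.map φ hφ' : H ⟶ AlgebraicGeometry.Proj (MvPolynomial.homogeneousSubmodule (Fin (n + 1))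
    O)))} → (C.support : Set X') ∩ (σ' ≫ (AlgebraicGeometry.Proj.toSpecZero (MvPolynomial.homogeneousSubmodule (Fin (n + 1)) O) ≫ AlgebraicGeometry.Spec.map (CommRingCat.ofHom
    (algebraMap O (MvPolynomial.homogeneousSubmodule (Fin (n + 1)) O 0))))) ⁻¹' {IsLocalRing.closedPoint O} ⊆ S' → Ch X'' (τ ≫ σ') (closure (τ ⁻¹' (S' \ (C.support : Set X'))))) → (∀
    (X' : AlgebraicGeometry.Scheme.{0}) (σ' : X' ⟶ (AlgebraicGeometry.Proj (MvPolynomial.homogeneousSubmodule (Fin (n + 1)) O))) (S' : Set X'), Ch X' σ' S' →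
    Summit.ResolutionOfSingularities.ResolutionOfSingularities.Theses.EquisingularLift.Split.Chain (AlgebraicGeometry.Proj (MvPolynomial.homogeneousSubmodule (Fin (n + 1)) O))
    (Set.range (ι ≫ AlgebraicGeometry.Proj.map φ hφ' : H ⟶ AlgebraicGeometry.Proj (MvPolynomial.homogeneousSubmodule (Fin (n + 1)) O))) X' σ' S') → (Set.range (ι ≫
    AlgebraicGeometry.Proj.map φ hφ' : H ⟶ AlgebraicGeometry.Proj (MvPolynomial.homogeneousSubmodule (Fin (n + 1)) O))) ⊆ (AlgebraicGeometry.Proj.toSpecZero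
    (MvPolynomial.homogeneousSubmodule (Fin (n + 1)) O) ≫ AlgebraicGeometry.Spec.map (CommRingCat.ofHom (algebraMap O (MvPolynomial.homogeneousSubmodule (Fin (n + 1)) O 0)))) ⁻¹'
    {IsLocalRing.closedPoint O} → IsIrreducible (Set.range (ι ≫ AlgebraicGeometry.Proj.map φ hφ' : H ⟶ AlgebraicGeometry.Proj (MvPolynomial.homogeneousSubmodule (Fin (n + 1)) O))) →
    IsClosed (Set.range (ι ≫ AlgebraicGeometry.Proj.map φ hφ' : H ⟶ AlgebraicGeometry.Proj (MvPolynomial.homogeneousSubmodule (Fin (n + 1)) O))) → AlgebraicGeometry.IsIntegral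
    (AlgebraicGeometry.Proj (MvPolynomial.homogeneousSubmodule (Fin (n + 1)) O)) → IsLocallyNoetherian (AlgebraicGeometry.Proj (MvPolynomial.homogeneousSubmodule (Fin (n + 1)) O)) →
    Literature.AlgebraicGeometry.Resolution.Scheme.IsRegular (AlgebraicGeometry.Proj (MvPolynomial.homogeneousSubmodule (Fin (n + 1)) O)) → AlgebraicGeometry.IsProper
    (AlgebraicGeometry.Proj.toSpecZero (MvPolynomial.homogeneousSubmodule (Fin (n + 1)) O) ≫ AlgebraicGeometry.Spec.map (CommRingCat.ofHom (algebraMap O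
    (MvPolynomial.homogeneousSubmodule (Fin (n + 1)) O 0)))) → AlgebraicGeometry.SmoothOfRelativeDimension n (AlgebraicGeometry.Proj.toSpecZero (MvPolynomial.homogeneousSubmodule
    (Fin (n + 1)) O) ≫ AlgebraicGeometry.Spec.map (CommRingCat.ofHom (algebraMap O (MvPolynomial.homogeneousSubmodule (Fin (n + 1)) O 0)))) → Ch (AlgebraicGeometry.Proj
    (MvPolynomial.homogeneousSubmodule (Fin (n + 1)) O)) (𝟙 (AlgebraicGeometry.Proj (MvPolynomial.homogeneousSubmodule (Fin (n + 1)) O))) (Set.range (ι ≫ AlgebraicGeometry.Proj.map φ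
    hφ' : H ⟶ AlgebraicGeometry.Proj (MvPolynomial.homogeneousSubmodule (Fin (n + 1)) O))) → AlgebraicGeometry.IsDominant (𝟙 (AlgebraicGeometry.Proj
    (MvPolynomial.homogeneousSubmodule (Fin (n + 1)) O)) ≫ (AlgebraicGeometry.Proj.toSpecZero (MvPolynomial.homogeneousSubmodule (Fin (n + 1)) O) ≫ AlgebraicGeometry.Spec.map
    (CommRingCat.ofHom (algebraMap O (MvPolynomial.homogeneousSubmodule (Fin (n + 1)) O 0))))) → AlgebraicGeometry.IsIntegral (Literature.AlgebraicGeometry.Motives.projectiveSpace n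
    k).left → ∀ (t : (Literature.AlgebraicGeometry.Motives.projectiveSpace n k).left ⟶ AlgebraicGeometry.Spec (.of k)), IsPullback (AlgebraicGeometry.Proj.map φ hφ' :
    (Literature.AlgebraicGeometry.Motives.projectiveSpace n k).left ⟶ AlgebraicGeometry.Proj (MvPolynomial.homogeneousSubmodule (Fin (n + 1)) O)) t (𝟙 (AlgebraicGeometry.Proj
    (MvPolynomial.homogeneousSubmodule (Fin (n + 1)) O)) ≫ (AlgebraicGeometry.Proj.toSpecZero (MvPolynomial.homogeneousSubmodule (Fin (n + 1)) O) ≫ AlgebraicGeometry.Spec.map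
    (CommRingCat.ofHom (algebraMap O (MvPolynomial.homogeneousSubmodule (Fin (n + 1)) O 0))))) (AlgebraicGeometry.Spec.map (CommRingCat.ofHom θ)) → IsClosed (Set.range ι) →
    IsIrreducible (Set.range ι) → (AlgebraicGeometry.Proj.map φ hφ' : (Literature.AlgebraicGeometry.Motives.projectiveSpace n k).left ⟶ AlgebraicGeometry.Proj
    (MvPolynomial.homogeneousSubmodule (Fin (n + 1)) O)) '' Set.range ι = (Set.range (ι ≫ AlgebraicGeometry.Proj.map φ hφ' : H ⟶ AlgebraicGeometry.Proj
    (MvPolynomial.homogeneousSubmodule (Fin (n + 1)) O))) → ∀ (x : (Literature.AlgebraicGeometry.Motives.projectiveSpace n k).left) (hx : IsClosed ({x} : Set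
    (Literature.AlgebraicGeometry.Motives.projectiveSpace n k).left)) (U : (AlgebraicGeometry.Proj (MvPolynomial.homogeneousSubmodule (Fin (n + 1)) O)).Opens),
    AlgebraicGeometry.Smooth (U.ι ≫ 𝟙 (AlgebraicGeometry.Proj (MvPolynomial.homogeneousSubmodule (Fin (n + 1)) O)) ≫ (AlgebraicGeometry.Proj.toSpecZero
    (MvPolynomial.homogeneousSubmodule (Fin (n + 1)) O) ≫ AlgebraicGeometry.Spec.map (CommRingCat.ofHom (algebraMap O (MvPolynomial.homogeneousSubmodule (Fin (n + 1)) O 0))))) → ∀ (s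
    : AlgebraicGeometry.Spec (.of O) ⟶ (AlgebraicGeometry.Proj (MvPolynomial.homogeneousSubmodule (Fin (n + 1)) O))), s ≫ 𝟙 (AlgebraicGeometry.Proj (MvPolynomial.homogeneousSubmodule
    (Fin (n + 1)) O)) ≫ (AlgebraicGeometry.Proj.toSpecZero (MvPolynomial.homogeneousSubmodule (Fin (n + 1)) O) ≫ AlgebraicGeometry.Spec.map (CommRingCat.ofHom (algebraMap O
    (MvPolynomial.homogeneousSubmodule (Fin (n + 1)) O 0)))) = 𝟙 _ → s (IsLocalRing.closedPoint O) ∈ U → s (IsLocalRing.closedPoint O) = (AlgebraicGeometry.Proj.map φ hφ' :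
    (Literature.AlgebraicGeometry.Motives.projectiveSpace n k).left ⟶ AlgebraicGeometry.Proj (MvPolynomial.homogeneousSubmodule (Fin (n + 1)) O)) x → ringKrullDim
    ((AlgebraicGeometry.Proj (MvPolynomial.homogeneousSubmodule (Fin (n + 1)) O)).presheaf.stalk (s (IsLocalRing.closedPoint O))) = ((n + 1 : ℕ) : WithBot ℕ∞) → IsRegularLocalRing
    ((Literature.AlgebraicGeometry.Motives.projectiveSpace n k).left.presheaf.stalk x) → (∀ c ∈ (s.ker.support : Set (AlgebraicGeometry.Proj (MvPolynomial.homogeneousSubmodule (Fin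
    (n + 1)) O))), ¬ IsGenericPoint ((𝟙 (AlgebraicGeometry.Proj (MvPolynomial.homogeneousSubmodule (Fin (n + 1)) O)) : (AlgebraicGeometry.Proj (MvPolynomial.homogeneousSubmodule (Fin
    (n + 1)) O)) ⟶ (AlgebraicGeometry.Proj (MvPolynomial.homogeneousSubmodule (Fin (n + 1)) O))) c) (Set.range (ι ≫ AlgebraicGeometry.Proj.map φ hφ' : H ⟶ AlgebraicGeometry.Proj
    (MvPolynomial.homogeneousSubmodule (Fin (n + 1)) O)))) → ∀ (X₁ : AlgebraicGeometry.Scheme.{0}) (τ₁ : X₁ ⟶ (AlgebraicGeometry.Proj (MvPolynomial.homogeneousSubmodule (Fin (n + 1))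
    O))), Literature.AlgebraicGeometry.Resolution.IsBlowup τ₁ s.ker → AlgebraicGeometry.IsIntegral X₁ → IsLocallyNoetherian X₁ →
    Literature.AlgebraicGeometry.Resolution.Scheme.IsRegular X₁ → AlgebraicGeometry.IsDominant ((τ₁ ≫ 𝟙 (AlgebraicGeometry.Proj (MvPolynomial.homogeneousSubmodule (Fin (n + 1)) O)))
    ≫ (AlgebraicGeometry.Proj.toSpecZero (MvPolynomial.homogeneousSubmodule (Fin (n + 1)) O) ≫ AlgebraicGeometry.Spec.map (CommRingCat.ofHom (algebraMap O
    (MvPolynomial.homogeneousSubmodule (Fin (n + 1)) O 0))))) → ∀ (F₂ : AlgebraicGeometry.Scheme.{0}), AlgebraicGeometry.IsIntegral F₂ → ∀ (υ : F₂ ⟶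
    (Literature.AlgebraicGeometry.Motives.projectiveSpace n k).left), Literature.AlgebraicGeometry.Resolution.IsBlowup υ (AlgebraicGeometry.Scheme.IdealSheafData.vanishingIdeal
    (⟨{x}, hx⟩ : TopologicalSpace.Closeds (Literature.AlgebraicGeometry.Motives.projectiveSpace n k).left)) → ∀ (j₂ : F₂ ⟶ X₁) (t₂ : F₂ ⟶ AlgebraicGeometry.Spec (.of k)), IsPullback
    j₂ t₂ ((τ₁ ≫ 𝟙 (AlgebraicGeometry.Proj (MvPolynomial.homogeneousSubmodule (Fin (n + 1)) O))) ≫ (AlgebraicGeometry.Proj.toSpecZero (MvPolynomial.homogeneousSubmodule (Fin (n + 1))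
    O) ≫ AlgebraicGeometry.Spec.map (CommRingCat.ofHom (algebraMap O (MvPolynomial.homogeneousSubmodule (Fin (n + 1)) O 0))))) (AlgebraicGeometry.Spec.map (CommRingCat.ofHom θ)) → j₂
    ≫ τ₁ = υ ≫ (AlgebraicGeometry.Proj.map φ hφ' : (Literature.AlgebraicGeometry.Motives.projectiveSpace n k).left ⟶ AlgebraicGeometry.Proj (MvPolynomial.homogeneousSubmodule (Fin (n
    + 1)) O)) → (s.ker.comap τ₁).comap j₂ = (AlgebraicGeometry.Scheme.IdealSheafData.vanishingIdeal (⟨{x}, hx⟩ : TopologicalSpace.Closeds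
    (Literature.AlgebraicGeometry.Motives.projectiveSpace n k).left)).comap υ → IsIrreducible (closure (υ ⁻¹' (Set.range ι \ {x}))) → Ch X₁ (τ₁ ≫ 𝟙 (AlgebraicGeometry.Proj
    (MvPolynomial.homogeneousSubmodule (Fin (n + 1)) O))) (j₂ '' closure (υ ⁻¹' (Set.range ι \ {x}))) → ∀ (Ls₂ : List (Set F₂)),
    (letI := MvPolynomial.gradedAlgebra (σ := Fin (n + 1)) (R := k); ∀ L ∈ Ls₂, ∃ ℓ : MvPolynomial (Fin (n + 1)) k, ℓ.IsHomogeneous 1 ∧ ℓ ≠ 0 ∧ x ∈ {y :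
    (Literature.AlgebraicGeometry.Motives.projectiveSpace n k).left | ℓ ∈ (y : ProjectiveSpectrum (MvPolynomial.homogeneousSubmodule (Fin (n + 1)) k)).asHomogeneousIdeal} ∧ ¬
    (Set.range ι ⊆ {y : (Literature.AlgebraicGeometry.Motives.projectiveSpace n k).left | ℓ ∈ (y : ProjectiveSpectrum (MvPolynomial.homogeneousSubmodule (Fin (n + 1))
    k)).asHomogeneousIdeal}) ∧ L = closure (υ ⁻¹' ({y : (Literature.AlgebraicGeometry.Motives.projectiveSpace n k).left | ℓ ∈ (y : ProjectiveSpectrum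
    (MvPolynomial.homogeneousSubmodule (Fin (n + 1)) k)).asHomogeneousIdeal} \ {x}))) → ∀ (F₉ : AlgebraicGeometry.Scheme.{0}) (β : F₉ ⟶ F₂) (T₉ : Set F₉), ReachTowerBQuadPrime
    (Literature.AlgebraicGeometry.Motives.projectiveSpace n k).left F₂ υ x (closure (υ ⁻¹' (Set.range ι \ {x}))) Ls₂ F₉ β T₉ → ∃ (X₉ : AlgebraicGeometry.Scheme.{0}) (σ₉ : X₉ ⟶
    (AlgebraicGeometry.Proj (MvPolynomial.homogeneousSubmodule (Fin (n + 1)) O))) (S₉ : Set X₉) (j₉ : F₉ ⟶ X₉) (t₉ : F₉ ⟶ AlgebraicGeometry.Spec (.of k)), Ch X₉ σ₉ S₉ ∧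
    AlgebraicGeometry.IsIntegral X₉ ∧ IsLocallyNoetherian X₉ ∧ Literature.AlgebraicGeometry.Resolution.Scheme.IsRegular X₉ ∧ AlgebraicGeometry.IsDominant (σ₉ ≫
    (AlgebraicGeometry.Proj.toSpecZero (MvPolynomial.homogeneousSubmodule (Fin (n + 1)) O) ≫ AlgebraicGeometry.Spec.map (CommRingCat.ofHom (algebraMap O
    (MvPolynomial.homogeneousSubmodule (Fin (n + 1)) O 0))))) ∧ IsPullback j₉ t₉ (σ₉ ≫ (AlgebraicGeometry.Proj.toSpecZero (MvPolynomial.homogeneousSubmodule (Fin (n + 1)) O) ≫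
    AlgebraicGeometry.Spec.map (CommRingCat.ofHom (algebraMap O (MvPolynomial.homogeneousSubmodule (Fin (n + 1)) O 0))))) (AlgebraicGeometry.Spec.map (CommRingCat.ofHom θ)) ∧ j₉ ''
    T₉ = S₉ ∧ IsClosed T₉ ∧ IsIrreducible T₉ ∧ AlgebraicGeometry.IsIntegral F₉)) →
    -- (35th) the ND ROUND over the locally-Noetherian ND invariant (lead-2's closing module: `ND.ndInvLN_round`)
    ND.RoundFacts n k (ND.NDInvCLN n k) →
    -- (K6-1) the ND-LEAVES hypothesis
    IsoHypReachNDLeaves k n H ι → ELNatConclusionO k n H ι := by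
  intro hp k _ _ _ n H ι hι hH hloc HSUB₁ HSUB₂ hround h
  obtain ⟨F, ρ, T, m, hpre, hND⟩ := h
  -- the ND rounds from the prefix's END STAGE (`ND.rounds_resolve` is stage-generic): a resolved end reachable through every round-closed motive
  obtain ⟨F', ρ', T', hQ', hreg'⟩ := ND.rounds_resolve n k (ND.NDInvCLN n k) (ND.ndInvCLN_end n k) hround m F ρ T hND
  exact target_elnat_of_subchainResolution_letters p hp k n H ι hι hH hloc
    -- Reach := B‴ towers OR toric strata towers (the O-side lifts either: HSUB₁ resp. `ND.hsub_strataLift`, 35th ✓ p647090)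
    (fun F₁ F₂ υ x T₂ F₉ β T₉ => ReachTowerBTriplePrime F₁ F₂ υ x T₂ F₉ β T₉ ∨ ND.ReachToric n F₁ F₂ υ x T₂ F₉ β T₉)
    (fun F₂ υ x T₂ Ls₂ F₉ β T₉ => ReachTowerBQuadPrime (Literature.AlgebraicGeometry.Motives.projectiveSpace n k).left F₂ υ x T₂ Ls₂ F₉ β T₉)
    (fun F₂ υ x Ls₂ => (letI := MvPolynomial.gradedAlgebra (σ := Fin (n + 1)) (R := k); ∀ L ∈ Ls₂, ∃ ℓ : MvPolynomial (Fin (n + 1)) k, ℓ.IsHomogeneous 1 ∧ ℓ ≠ 0 ∧ x ∈ {y : (Literature.AlgebraicGeometry.Motives.projectiveSpace n k).left | ℓ ∈ (y : ProjectiveSpectrum (MvPolynomial.homogeneousSubmodule (Fin (n + 1)) k)).asHomogeneousIdeal} ∧ ¬ (Set.range ι ⊆ {y : (Literature.AlgebraicGeometry.Motives.projectiveSpace n k).left | ℓ ∈ (y : ProjectiveSpectrum (MvPolynomial.homogeneousSubmodule (Fin (n + 1)) k)).asHomogeneousIdeal}) ∧ L = closure (υ ⁻¹' ({y : (Literature.AlgebraicGeometry.Motives.projectiveSpace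 n k).left | ℓ ∈ (y : ProjectiveSpectrum (MvPolynomial.homogeneousSubmodule (Fin (n + 1)) k)).asHomogeneousIdeal} \ {x}))))
    -- HSUB(B‴ ∨ toric) by cases
    (fun O _ _ _ _ _ θ hθ P q Y Ch hChStep hChSplit hYsp hYirr hYcl hPint hPnoeth hPreg hqprop hqsm X' σ' S' hCh' hX'int hX'noeth hX'reg hX'dom F₁ hF₁ j t
        hsq T₁ hT₁cl hT₁irr hjT₁ x hx U hU s hs hsU hsx hdim hxreg hsoff X₁ τ₁ hτ₁ hX₁int hX₁noeth hX₁reg hX₁dom F₂ hF₂ υ hυ j₂ t₂ hsq₂ hcomm hcarrier hirr₂ hCh₁ F₉ β T₉ hR =>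
      Or.elim hR
        (fun h₁ => HSUB₁ O θ hθ P q Y Ch hChStep hChSplit hYsp hYirr hYcl hPint hPnoeth hPreg hqprop hqsm X' σ' S' hCh' hX'int hX'noeth hX'reg hX'dom F₁ hF₁ j t
          hsq T₁ hT₁cl hT₁irr hjT₁ x hx U hU s hs hsU hsx hdim hxreg hsoff X₁ τ₁ hτ₁ hX₁int hX₁noeth hX₁reg hX₁dom F₂ hF₂ υ hυ j₂ t₂ hsq₂ hcomm hcarrier hirr₂ hCh₁ F₉ β T₉ h₁)
        (fun h₂ => ND.hsub_strataLift k n O θ hθ P q Y Ch hChStep hChSplit hYsp hYirr hYcl hPint hPnoeth hPreg hqprop hqsm X' σ' S' hCh' hX'int hX'noeth hX'reg hX'dom F₁ hF₁ j t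
          hsq T₁ hT₁cl hT₁irr hjT₁ x hx U hU s hs hsU hsx hdim hxreg hsoff X₁ τ₁ hτ₁ hX₁int hX₁noeth hX₁reg hX₁dom F₂ hF₂ υ hυ j₂ t₂ hsq₂ hcomm hcarrier hirr₂ hCh₁ F₉ β T₉ h₂))
    HSUB₂
    ⟨F', ρ', T', fun Q hQ0 hQc hQL => hQ' Q
        (fun F₁ F₂ ρ₁ T₁ x υ hx hQ hn hr hυ => ⟨(hQc F₁ F₂ ρ₁ T₁ x υ hx hQ hn hr hυ).1,
          fun F₉ β T₉ hR => (hQc F₁ F₂ ρ₁ T₁ x υ hx hQ hn hr hυ).2 F₉ β T₉ (Or.inr hR)⟩)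
        (hpre Q hQ0 (fun F₁ F₂ ρ₁ T₁ x υ hx hQ hn hr hυ => ⟨(hQc F₁ F₂ ρ₁ T₁ x υ hx hQ hn hr hυ).1,
          fun F₉ β T₉ hR => (hQc F₁ F₂ ρ₁ T₁ x υ hx hQ hn hr hυ).2 F₉ β T₉ (Or.inl hR)⟩) hQL), hreg'⟩


/-- **THE RUNG `nd_leaves_rung_three` (n = 3) — «A⁗-PREFIX ⊕ ND LEAVES»**: for a locally principal integral closed `H ⊆ ℙ³_k` (`k` algebraically closed of
characteristic `p`) such that some A⁗-prefix ends at a stage with ND leaves (`IsoHypReachNDLeaves k 3 H ι`), there is a complete DVR `O ↠ k` of characteristic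
`0` with algebraically closed residue field over which the equisingular chain reaches a stage with regular reduced strict transform (`ELNatConclusionO`) —
MODULO the embedded-curve lift fact `EmbeddedCurveLiftFact` (T-k, F-88; exactly as rung⁵) — the ND round is the tree's `ND.ndInvLN_round` (35th ✓ p647090).  PROOF = (K6-2) fed with rung⁵
`stub_elnat_defTowerBQuadPrimePointResolutionThree`'s two supplier lambdas VERBATIM. [folklore; assembly] [cite: GortzWedhorn2020, Prop. 13.91]
[OURS · L1 W4.5b · candidate rung of the 37th cut (desk R33 (γ)); helper toward stmt-ResolutionOfSingularities-20148; NOT a statement of the manuscript] -/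
theorem nd_leaves_rung_three (p : ℕ) : EmbeddedCurveLiftFact → p.Prime → ∀ (k : Type) [Field k] [CharP k p] [IsAlgClosed k] (H :
    AlgebraicGeometry.Scheme.{0}) (ι : H ⟶ (Literature.AlgebraicGeometry.Motives.projectiveSpace 3 k).left), AlgebraicGeometry.IsClosedImmersion ι →
    AlgebraicGeometry.IsIntegral H → (∀ y : (Literature.AlgebraicGeometry.Motives.projectiveSpace 3 k).left, ∃ U : (Literature.AlgebraicGeometry.Motives.projectiveSpace 3
    k).left.affineOpens, y ∈ (U : (Literature.AlgebraicGeometry.Motives.projectiveSpace 3 k).left.Opens) ∧ (ι.ker.ideal U).IsPrincipal) →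
    IsoHypReachNDLeaves k 3 H ι → ELNatConclusionO k 3 H ι:= by
  intro hFact hp k _ _ _ H ι hι hH hloc h
  exact target_elnat_of_prefix_then_ndRounds p hp k 3 H ι hι hH hloc
    -- HSUB₁ (abstract stage, no letters): rung⁗'s supplier VERBATIM — stub-4's V10⁗-full ∘ (T-k) ∘ res-type-027's `inv_baseSL`
    (fun O _ _ _ _ _ θ hθ P q Y Ch hChStep hChSplit hYsp hYirr hYcl hPint hPnoeth hPreg hqprop hqsm X' σ' S' hCh' hX'int hX'noeth hX'reg hX'dom F₁ hF₁ j t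
        hsq T₁ hT₁cl hT₁irr hjT₁ x hx U hU s hs hsU hsx hdim hxreg hsoff X₁ τ₁ hτ₁ hX₁int hX₁noeth hX₁reg hX₁dom F₂ hF₂ υ hυ j₂ t₂ hsq₂ hcomm hcarrier
        hirr₂ hCh₁ =>
      hsub_reachTowerBTriplePrime_of_fact_full k O θ hθ P q Y Ch hChStep hChSplit hYsp hYirr hYcl hPint hPnoeth hPreg hqprop hqsm X' σ' S' hCh' hX'int hX'noeth
        hX'reg hX'dom F₁ hF₁ j t hsq T₁ hT₁cl hT₁irr hjT₁ x hx U hU s hs hsU hsx hdim hxreg hsoff X₁ τ₁ hτ₁ hX₁int hX₁noeth hX₁reg hX₁dom F₂ hF₂ υ hυ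
        j₂ t₂ hsq₂ hcomm hcarrier hirr₂ hCh₁ (hFact k O θ hθ P q)
        -- the SL-BASE (plane list seeded `[υ⁻¹{x}]`, conical `W`): res-type-027's `inv_baseSL` (A‴ (U6)), in characteristic `p` of `k`
        (fun W _ hnot _ hcone => by
          haveI : Fact p.Prime := ⟨hp⟩
          haveI := hqprop; haveI := hX'int; haveI := hX'noeth; haveI := hF₁; haveI := hX₁int; haveI := hX₁noeth; haveI := hF₂
          exact inv_baseSL p k O θ hθ P q Y Ch hChSplit hPnoeth hPreg X' σ' S' hCh' hX'reg F₁ j t hsq T₁ x hx hxreg U hU s hs hsU hsx hdim hsoff X₁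
            τ₁ hτ₁ hX₁reg hX₁dom F₂ υ hυ j₂ t₂ hsq₂ hcomm hcarrier hCh₁ hirr₂ W hnot hcone))
    -- HSUB₂ (initial stage, hyperplane letters): stub-4's V10⁵-full, seeds by res-type-027's lettered bases, letter data by (H3) + (H4-T)
    (fun O _ _ _ _ _ θ hθ φ hφ' hφ Ch hChStep hChSplit hYsp hYirr hYcl hPint hPnoeth hPreg hqprop hqsm hCh₀ hdom₀ hF₁int t hsq hT₁cl hT₁irr hjT₁ x hx U hU s hs hsU
        hsx hdim hxreg hsoff X₁ τ₁ hτ₁ hX₁int hX₁noeth hX₁reg hX₁dom F₂ hF₂ υ hυ j₂ t₂ hsq₂ hcomm hcarrier hirr₂ hCh₁ Ls₂ hLS => by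
      haveI : Fact p.Prime := ⟨hp⟩
      haveI := hqprop; haveI := hPint; haveI := hPnoeth; haveI := hF₁int; haveI := hX₁int; haveI := hX₁noeth; haveI := hF₂
      -- `ℙⁿ_k` is locally Noetherian: `Proj φ` is a closed immersion into the locally Noetherian `ℙⁿ_O` (base change of `Spec θ`)
      haveI : IsClosedImmersion (Spec.map (CommRingCat.ofHom θ)) := IsClosedImmersion.spec_of_surjective _ hθ
      have hjci : IsClosedImmersion (Proj.map φ hφ' : (Literature.AlgebraicGeometry.Motives.projectiveSpace 3 k).left ⟶
          Proj (MvPolynomial.homogeneousSubmodule (Fin (3 + 1)) O)) :=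
        MorphismProperty.IsStableUnderBaseChange.of_isPullback hsq.flip inferInstance
      have hjfin := ((IsClosedImmersion.iff_isFinite_and_mono _).mp hjci).1
      have hjft := ((IsFinite.iff_isIntegralHom_and_locallyOfFiniteType _).mp hjfin).2
      haveI : IsLocallyNoetherian (Literature.AlgebraicGeometry.Motives.projectiveSpace 3 k).left :=
        @LocallyOfFiniteType.isLocallyNoetherian _ _ _ hjft hPnoeth
      -- `range ι` is not the point `x` (its strict transform is non-empty)
      have hTx : ¬ Set.range ι ⊆ {x} := by
        obtain ⟨y, hy⟩ := closure_nonempty_iff.mp hirr₂.nonempty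
        exact fun h => hy.2 (h hy.1)
      -- the hyperplanes `V₊(ℓ)` are closed (a zero locus of the projective spectrum)
      have hVcl : ∀ ℓ : MvPolynomial (Fin (3 + 1)) k, IsClosed {y : (Literature.AlgebraicGeometry.Motives.projectiveSpace 3 k).left |
          ℓ ∈ (y : ProjectiveSpectrum (MvPolynomial.homogeneousSubmodule (Fin (3 + 1)) k)).asHomogeneousIdeal} := fun ℓ => by
        have h := ProjectiveSpectrum.isClosed_zeroLocus (MvPolynomial.homogeneousSubmodule (Fin (3 + 1)) k)
          ({ℓ} : Set (MvPolynomial (Fin (3 + 1)) k))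
        have hS : {y : ProjectiveSpectrum (MvPolynomial.homogeneousSubmodule (Fin (3 + 1)) k) | ℓ ∈ y.asHomogeneousIdeal} =
            ProjectiveSpectrum.zeroLocus (MvPolynomial.homogeneousSubmodule (Fin (3 + 1)) k) {ℓ} :=
          Set.ext fun y => by simp only [ProjectiveSpectrum.mem_zeroLocus, Set.mem_setOf_eq, Set.singleton_subset_iff, SetLike.mem_coe]
        rw [← hS] at h
        exact h
      -- the letters' downstairs bookkeeping: closed, not containing the strict transform of `range ι`
      have hLs₂ : ∀ L ∈ Ls₂, IsClosed L ∧ ¬ closure (υ ⁻¹' (Set.range ι \ {x})) ⊆ L := by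
        intro L hL
        obtain ⟨ℓ, -, -, -, hHℓ, rfl⟩ := hLS L hL
        exact ⟨isClosed_closure, not_closure_preimage_diff_subset hυ hT₁irr (hVcl ℓ) hx hHℓ hTx
          (Scheme.IdealSheafData.coe_support_vanishingIdeal _).le⟩
      -- the letters' MODEL data at `(X₁, τ₁ ≫ 𝟙, j₂)`: (H3) a hyperplane model through the section, then (H4-T) its strict transform
      have hLsD : ∀ L ∈ Ls₂, TCPlus.LetterDatum O (Proj (MvPolynomial.homogeneousSubmodule (Fin (3 + 1)) O))
          (Proj.toSpecZero (MvPolynomial.homogeneousSubmodule (Fin (3 + 1)) O) ≫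
            Spec.map (CommRingCat.ofHom (algebraMap O (MvPolynomial.homogeneousSubmodule (Fin (3 + 1)) O 0))))
          (Set.range (ι ≫ Proj.map φ hφ')) F₂ X₁ (τ₁ ≫ 𝟙 _) j₂ L := by
        intro L hL
        obtain ⟨ℓ, hℓ1, hℓ0, hxℓ, hHℓ, rfl⟩ := hLS L hL
        obtain ⟨-, -, fO, hfO', -, -, -, -, h1, h2, h3, h4, h5, hle⟩ :=
          @LinearLetter.exists_letter_model_le_ker O k _ _ _ _ θ hθ 2 φ hφ hφ' s hs x hsx ℓ hℓ1 hℓ0 hxℓ H hH ι hι hHℓ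
        have hVne : closure {y : (Literature.AlgebraicGeometry.Motives.projectiveSpace 3 k).left |
            ℓ ∈ (y : ProjectiveSpectrum (MvPolynomial.homogeneousSubmodule (Fin (3 + 1)) k)).asHomogeneousIdeal} ≠ Set.univ := by
          rw [(hVcl ℓ).closure_eq]
          exact fun h => hHℓ (h ▸ Set.subset_univ _)
        exact letter_strictTransform_of_le_ker k O θ hθ _ _ _ _ (𝟙 _) hPreg _ (Proj.map φ hφ') t hsq x hx s hs hsx X₁ τ₁ hτ₁ F₂ υ hυ j₂ hcomm
          _ _ hVne h1 h2 h3 h4 h5 hle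
      exact hsub_reachTowerBQuadPrime_of_fact_full k O θ hθ _ _ _ Ch hChStep hChSplit hYsp hYirr hYcl hPint hPnoeth hPreg hqprop hqsm _ (𝟙 _) _ hCh₀ hPint
        hPnoeth hPreg hdom₀ _ hF₁int (Proj.map φ hφ') t hsq (Set.range ι) hT₁cl hT₁irr hjT₁ x hx U hU s hs hsU hsx hdim hxreg hsoff X₁ τ₁ hτ₁ hX₁int hX₁noeth
        hX₁reg hX₁dom F₂ hF₂ υ hυ j₂ t₂ hsq₂ hcomm hcarrier hirr₂ hCh₁ Ls₂ hLs₂ (hFact k O θ hθ _ _)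
        -- the SL-BASE with letters (conical `W`): res-type-027's `inv_baseSL_letters`, in characteristic `p` of `k`
        (fun W _ hnot _ hcone =>
          inv_baseSL_letters p k O θ hθ _ _ _ Ch hChSplit hPnoeth hPreg _ (𝟙 _) _ hCh₀ hPreg _ (Proj.map φ hφ') t hsq (Set.range ι) x hx hxreg U hU s hs hsU
            hsx hdim hsoff X₁ τ₁ hτ₁ hX₁reg hX₁dom F₂ υ hυ j₂ t₂ hsq₂ hcomm hcarrier hCh₁ hirr₂ W hnot hcone Ls₂ hLsD)
        -- the S₀L-BASE with letters (shadow-free `W`): res-type-027's `inv_baseS₀L_letters` (char-free)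
        (fun W hxW hnot hWpr =>
          inv_baseS₀L_letters k O θ hθ _ _ _ Ch hChSplit hPnoeth hPreg _ (𝟙 _) _ hCh₀ hPreg _ (Proj.map φ hφ') t hsq (Set.range ι) x hx hxreg U hU s hs hsU
            hsx hdim hsoff X₁ τ₁ hτ₁ hX₁reg hX₁dom F₂ υ hυ j₂ t₂ hsq₂ hcomm hcarrier hCh₁ hirr₂ W hxW hnot hWpr Ls₂ hLsD))
    -- (35th) the ND round, and the ND-LEAVES hypothesis
    (ND.ndInvLN_round 3 k) h

/-- **MONOTONICITY** — the ND-K5 stub's hypothesis (`IsoHypNDWon` + finitely many non-regular points) is the EMPTY-PREFIX case of `IsoHypReachNDLeaves`, by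
✓ p645490 `ND.ndInv_init` (B4γ) at floor 0 (+ `ℙⁿ_k` locally Noetherian, `range ι` closed).  So the 37th cut may REPLACE the ND blob by the ND-leaves blob.
[OURS · pure logic over ✓ p645490] -/
theorem isoHypReachNDLeaves_of_isoHypNDWon (n : ℕ) (p : ℕ) (hp : p.Prime) (k : Type) [Field k] [CharP k p] [IsAlgClosed k]
    (H : AlgebraicGeometry.Scheme.{0}) (ι : H ⟶ (Literature.AlgebraicGeometry.Motives.projectiveSpace n k).left)
    (hι : AlgebraicGeometry.IsClosedImmersion ι) (hH : AlgebraicGeometry.IsIntegral H)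
    (hloc : ∀ y : (Literature.AlgebraicGeometry.Motives.projectiveSpace n k).left,
      ∃ U : (Literature.AlgebraicGeometry.Motives.projectiveSpace n k).left.affineOpens,
        y ∈ (U : (Literature.AlgebraicGeometry.Motives.projectiveSpace n k).left.Opens) ∧ (ι.ker.ideal U).IsPrincipal)
    (hfin : Set.Finite {x : H | ¬ IsRegularLocalRing (H.presheaf.stalk x)}) (hND : IsoHypNDWon k n H ι) :
    IsoHypReachNDLeaves k n H ι := by
  obtain ⟨m, hm⟩ := ND.ndInv_init n p hp k H ι hι hH hloc hfin hND
  haveI := hι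
  have hLNP : IsLocallyNoetherian (Literature.AlgebraicGeometry.Motives.projectiveSpace n k).left :=
    AlgebraicGeometry.LocallyOfFiniteType.isLocallyNoetherian (Literature.AlgebraicGeometry.Motives.projectiveSpace n k).hom
  exact ⟨_, _, _, m, fun Q hQ0 _ _ => hQ0, ⟨hm, ι.isClosedEmbedding.isClosed_range⟩, hLNP⟩

end Summit.ResolutionOfSingularities.ResolutionOfSingularities.Cruxes.EquisingularLiftNat.Sections

end
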